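import Mathlib.Analysis.Convex.Jensen
import Mathlib.Analysis.Convex.Combination
import Mathlib.Order.Interval.Set.Pi
import Mathlib.Data.Real.Basic
import Mathlib.LinearAlgebra.AffineSpace.AffineMap
import HarnessLib

/-!
# Minimum of a concave "fixed-dual" bound over a box is attained at a vertex
# (Rockafellar 1970, §32, Thm 32.2 — concave/minimum form; folklore algebra)

Venture CertifiedManyBodySolver, cell hubbard-fast (D-0042 R1b fast layer / R2(e) region-valid dual certificates), seat hubbard-fast-eng; namespace `Summit.Ventures.CertifiedManyBodySolver.Transport.BoxCertificate`. Everything here is PROVED (Mathlib only). HONEST FRAMING: first certified bounds; not a superconductivity verdict; every number certified or labelled float.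

Motivation (region-valid dual certificates for parametrised conic relaxations). Let `P(θ)` be a
family of conic programs whose data depend AFFINELY on a parameter `θ` (objective, right-hand
sides, constraint rows, PSD entry forms), and fix ONE dual point (PSD multipliers, equality
multipliers `λ`, inequality multipliers `κ ≥ 0`). The rigorous (Jansson-type) lower bound it
yields for the value of `P(θ)` has the shape
`β(θ) = a(θ) - ∑ᵢ Bᵢ |ℓᵢ(θ)|`
with `a, ℓᵢ` affine in `θ` (the exact residual of the dual equations is affine in the data) and
`Bᵢ ≥ 0` the a-priori bounds of the primal variables. Such a `β` is CONCAVE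
(`concaveOn_affine_sub_sum_abs`), so by the minimum principle for concave functions
(Rockafellar 1970, Thm 32.2: the supremum of a convex function over `conv S` equals its supremum
over `S`; here in the mirrored form, Mathlib's `ConcaveOn.exists_le_of_mem_convexHull`) its
minimum over a polytope is attained at a vertex. For a coordinate box `Set.Icc lo hi ⊆ (κ → ℝ)`
the vertices are the `2^|κ|` points of `Fintype.piFinset fun k => {lo k, hi k}`
(`Icc_subset_convexHull_boxVertices`), whence the BOX CERTIFICATE rule
`le_affine_sub_sum_abs_of_forall_boxVertices`: if `m ≤ β(v)` at every vertex `v` then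
`m ≤ β(θ)` on the whole box — one certificate, finitely many exact evaluations, a whole region.

What is NOT here: any statement about a particular relaxation (the instantiation `a = c₀ + p_norm
+ λ·b_eq − κ·b_le`, `ℓᵢ = pᵢ` is the user's); strict concavity; unbounded variables (they must
carry `ℓᵢ ≡ 0`, i.e. be absent from the sum).
-/

namespace Summit.Ventures.CertifiedManyBodySolver.Transport.BoxCertificate

open Set

variable {E : Type*} [AddCommGroup E] [Module ℝ E]

/-- A real-valued affine map is concave on the whole space (it is linear plus a constant).
[folklore] -/
theorem affineMap_concaveOn (a : E →ᵃ[ℝ] ℝ) : ConcaveOn ℝ univ (a : E → ℝ) := by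
  rw [a.decomp]
  exact (a.linear.concaveOn convex_univ).add (concaveOn_const _ convex_univ)

/-- A real-valued affine map is convex on the whole space. [folklore] -/
theorem affineMap_convexOn (a : E →ᵃ[ℝ] ℝ) : ConvexOn ℝ univ (a : E → ℝ) := by
  rw [a.decomp]
  exact (a.linear.convexOn convex_univ).add (convexOn_const _ convex_univ)

/-- The absolute value of a real affine map is convex: `|g| = max (g, -g)` is a maximum of two
affine (hence convex) functions. [folklore] -/
theorem affineMap_abs_convexOn (g : E →ᵃ[ℝ] ℝ) : ConvexOn ℝ univ (fun θ => |g θ|) := by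
  have h1 : ConvexOn ℝ univ (g : E → ℝ) := affineMap_convexOn g
  have h2 : ConvexOn ℝ univ (fun θ => -g θ) := (affineMap_concaveOn g).neg
  have h3 := h1.sup h2
  refine ⟨convex_univ, ?_⟩
  intro x _ y _ p q hp hq hpq
  have key := h3.2 (mem_univ x) (mem_univ y) hp hq hpq
  simp only [Pi.sup_apply] at key
  have ex : ∀ z : E, (g z ⊔ -g z) = |g z| := fun z => (abs_eq_max_neg).symm
  rw [ex, ex, ex] at key
  exact key

/-- A nonnegative combination `θ ↦ ∑ i ∈ s, B i * |ℓ i θ|` of absolute values of real affine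
maps is convex. [folklore] -/
theorem convexOn_sum_mul_abs_affineMap {ι : Type*} (s : Finset ι) (ℓ : ι → E →ᵃ[ℝ] ℝ)
    (B : ι → ℝ) (hB : ∀ i ∈ s, 0 ≤ B i) :
    ConvexOn ℝ univ (fun θ => ∑ i ∈ s, B i * |ℓ i θ|) := by
  classical
  induction s using Finset.induction_on with
  | empty =>
    simpa using (convexOn_const (𝕜 := ℝ) (0 : ℝ) (convex_univ : Convex ℝ (univ : Set E)))
  | insert a s ha ih =>
    have hBa : 0 ≤ B a := hB a (Finset.mem_insert_self a s)
    have ih' := ih (fun i hi => hB i (Finset.mem_insert_of_mem hi))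
    have hterm : ConvexOn ℝ univ (fun θ => B a * |ℓ a θ|) := by
      simpa [smul_eq_mul] using (affineMap_abs_convexOn (ℓ a)).smul hBa
    have hsum := hterm.add ih'
    refine ⟨convex_univ, ?_⟩
    intro x _ y _ p q hp hq hpq
    have key := hsum.2 (mem_univ x) (mem_univ y) hp hq hpq
    simp only [Finset.sum_insert ha, smul_eq_mul, Pi.add_apply] at key ⊢
    exact key

/-- **Concavity of a fixed-dual bound over an affine family.** For a real affine map `a`,
real affine maps `ℓ i` and weights `B i ≥ 0`, the function `θ ↦ a θ - ∑ i ∈ s, B i * |ℓ i θ|` is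
concave on the whole parameter space. (This is the shape of the rigorous dual lower bound of a
conic program with affinely parametrised data and a FIXED dual point: affine part minus the
weighted ℓ¹-norm of the affine residual.) [folklore] -/
theorem concaveOn_affine_sub_sum_abs {ι : Type*} (s : Finset ι) (a : E →ᵃ[ℝ] ℝ)
    (ℓ : ι → E →ᵃ[ℝ] ℝ) (B : ι → ℝ) (hB : ∀ i ∈ s, 0 ≤ B i) :
    ConcaveOn ℝ univ (fun θ => a θ - ∑ i ∈ s, B i * |ℓ i θ|) :=
  (affineMap_concaveOn a).sub (convexOn_sum_mul_abs_affineMap s ℓ B hB)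

/-- **Minimum principle** (Rockafellar 1970, Thm 32.2, in the concave/minimum form): a function
concave on the whole space attains, on the convex hull of a finite set `t`, no value below its
minimum over `t` — for every `θ ∈ conv t` some `v ∈ t` has `f v ≤ f θ`.
[cite: Rockafellar1970, Thm 32.2] -/
theorem exists_le_of_mem_convexHull_of_concaveOn {f : E → ℝ} (hf : ConcaveOn ℝ univ f)
    (t : Finset E) {θ : E} (hθ : θ ∈ convexHull ℝ (t : Set E)) : ∃ v ∈ t, f v ≤ f θ := by
  obtain ⟨v, hv, h⟩ := hf.exists_le_of_mem_convexHull (subset_univ _) hθ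
  exact ⟨v, hv, h⟩

/-- A coordinate box `Set.Icc lo hi` in `κ → ℝ` (`κ` finite) lies in the convex hull of its
`2^|κ|` vertices `Fintype.piFinset fun k => {lo k, hi k}` (no hypothesis `lo ≤ hi` is needed: an
empty box is trivially covered). [folklore] -/
theorem Icc_subset_convexHull_boxVertices {κ : Type*} [Fintype κ] [DecidableEq κ]
    (lo hi : κ → ℝ) :
    Set.Icc lo hi ⊆ convexHull ℝ
      ((Fintype.piFinset fun k => ({lo k, hi k} : Finset ℝ)) : Set (κ → ℝ)) := by
  intro θ hθ
  rw [Fintype.coe_piFinset, convexHull_pi]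
  simp only [Set.mem_pi, Set.mem_univ, true_implies, Finset.coe_insert, Finset.coe_singleton]
  intro k
  rw [convexHull_pair, segment_eq_Icc']
  exact ⟨le_trans (min_le_left _ _) (hθ.1 k), le_trans (hθ.2 k) (le_max_right _ _)⟩

/-- **Box certificate rule.** Let `β θ = a θ - ∑ i ∈ s, B i * |ℓ i θ|` with `a, ℓ i` real affine
maps on `κ → ℝ` (`κ` finite) and `B i ≥ 0`. If `m ≤ β v` at every vertex `v` of the box
`[lo, hi]` (the points of `Fintype.piFinset fun k => {lo k, hi k}`), then `m ≤ β θ` for EVERY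
`θ ∈ Set.Icc lo hi`. Application: one dual certificate of an affinely parametrised relaxation,
evaluated exactly at the `2^|κ|` box corners, certifies the bound `m` on the whole parameter box.
[cite: Rockafellar1970, Thm 32.2] -/
theorem le_affine_sub_sum_abs_of_forall_boxVertices {ι κ : Type*} [Fintype κ] [DecidableEq κ]
    (s : Finset ι) (a : (κ → ℝ) →ᵃ[ℝ] ℝ) (ℓ : ι → (κ → ℝ) →ᵃ[ℝ] ℝ) (B : ι → ℝ)
    (hB : ∀ i ∈ s, 0 ≤ B i) (lo hi : κ → ℝ) (m : ℝ)
    (hm : ∀ v ∈ Fintype.piFinset (fun k => ({lo k, hi k} : Finset ℝ)),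
      m ≤ a v - ∑ i ∈ s, B i * |ℓ i v|)
    {θ : κ → ℝ} (hθ : θ ∈ Set.Icc lo hi) :
    m ≤ a θ - ∑ i ∈ s, B i * |ℓ i θ| := by
  obtain ⟨v, hv, hle⟩ := exists_le_of_mem_convexHull_of_concaveOn
    (concaveOn_affine_sub_sum_abs s a ℓ B hB) _ (Icc_subset_convexHull_boxVertices lo hi hθ)
  exact (hm v hv).trans hle

/-- **Segment (one-parameter) form** of the box certificate rule: if `m ≤ β x` and `m ≤ β y` then
`m ≤ β θ` for every `θ` on the segment `[x, y]` of the parameter space, `β` as above.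
[cite: Rockafellar1970, Thm 32.2] -/
theorem le_affine_sub_sum_abs_of_mem_segment {ι : Type*} (s : Finset ι) (a : E →ᵃ[ℝ] ℝ)
    (ℓ : ι → E →ᵃ[ℝ] ℝ) (B : ι → ℝ) (hB : ∀ i ∈ s, 0 ≤ B i) (m : ℝ) {x y θ : E}
    (hx : m ≤ a x - ∑ i ∈ s, B i * |ℓ i x|) (hy : m ≤ a y - ∑ i ∈ s, B i * |ℓ i y|)
    (hθ : θ ∈ segment ℝ x y) :
    m ≤ a θ - ∑ i ∈ s, B i * |ℓ i θ| := by
  have h := (concaveOn_affine_sub_sum_abs s a ℓ B hB).min_le_of_mem_segment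
    (mem_univ x) (mem_univ y) hθ
  exact le_trans (le_min hx hy) h

end Summit.Ventures.CertifiedManyBodySolver.Transport.BoxCertificate
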